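import Summits.Ventures.Crystal3D.Theorems.StickyWulffConstantGenericWallFloorStackLedgerOneSidedDirs
import Summits.Ventures.Crystal3D.Theorems.StickyWulffConstantGenericWallFloorAtHalfWide
import HarnessLib

/-!
# One-sided floors for ANY steering vertical under the weak direction floor `hdirs`: the `TwoSlabLedgerAt` /
# `GenericWallFloorAtCharge` packaging of `…StackLedgerOneSidedDirs` (crux `GenericWallFloor`, stmt-Ventures-19480, line `WallLedgerG`)

HONEST FRAMING. Venture `Summits/Ventures/Crystal3D` (cell `crystal3d-full`), helper `--supports` the crux `GenericWallFloor`
of `route-Ventures-StickyWulffConstant`, REGISTERED line `WallLedgerG`, open stub `stub_twoSlabAdhesion`.  Rung credit only;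
F-C1 not moved; NOT the crux (charges `< 1`; inputs `ExactOnly`(C12-55) [E1], `StarPairFar` BY NAME, and the W1 hypothesis
`hdirs` — the SIGN invariant of the walker family's held directions — which is NOT discharged here).

`…AtHalfWide` packages `twoSlabAdhesion_stackLedger_oneSided_wide` (tilt `‖z − e₃‖ ≤ 1/3`); this file packages
`twoSlabAdhesion_stackLedger_oneSided_dirs` (19480-p2 g8: ANY unit steering `z`, launch slot `u₁` `z`-steep with true rise
`δ ≤ (A₁u₁)₂`, weak direction floor `hdirs`, rim counting) in the same currencies:
* `twoSlabLedgerAt_oneSided_dirs` — `TwoSlabLedgerAt (√2|⟪A₁u₁,e₃⟫|/2) A₁ t₁ A₂ t₂`, modulo `ExactOnly`(C12-55) and `StarPairFar`;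
* `genericWallFloorAtCharge_oneSided_dirs_of_far` — `GenericWallFloorAtCharge (√2|⟪A₁u₁,e₃⟫|/2)` with an abstract frame set `M₁`;
* `genericWallFloorAtCharge_oneSided_dirs` — the same with the CANONICAL frame set (frames of sound well-formed `z`-stacks over
  `⟨A₁, u₁, 0⟩`), charge written `√2·(A₁u₁)₂/2` (no absolute value: `(A₁u₁)₂ ≥ δ > 0`);
* `genericWallFloorAtCharge_word_dirs` — the WORD floor for any steering: chain pair `A₂·Λ₀ = (wordFrame A₁ κ)·Λ₀`, `|κ| ≥ 2`,
  `u₁` in the first mirror plane (`image_ne_of_word` is steering-free), so the tilt threshold `⟪A₁u₁,e₃⟫ ≥ 9/20` of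
  `genericWallFloorAtCharge_word_wide_of_inner_ge` becomes «`u₁` steep for SOME unit `z` whose family satisfies `hdirs`».
WHAT THIS IS NOT: not `c₀ = 1`; `hdirs` not discharged (19480-p1 g9); grain 2's mirror versions not here; F-C1 not moved.
-/

noncomputable section

namespace Summit.Ventures.Crystal3D.Theorems

open Summit.Ventures.Crystal3D Finset
open Literature.MathematicalPhysics.StatisticalMechanics (fccStacking barlowStacking IsHaggSeq)
open scoped InnerProductSpace

open scoped Classical in
/-- **`TwoSlabLedgerAt` from grain 1 alone, any steering, weak direction floor**, modulo `ExactOnly`(C12-55) and `StarPairFar`. -/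
theorem twoSlabLedgerAt_oneSided_dirs
    {s₀ : EuclideanSpace ℝ (Fin 3)} (hs₀ : s₀ ∈ fccSlots)
    (hcert : ExactOnly 0 (fccSlots.filter fun w => 0 < ⟪w, s₀⟫_ℝ)) (hSP : StarPairFar)
    (A₁ : EuclideanSpace ℝ (Fin 3) ≃ₗᵢ[ℝ] EuclideanSpace ℝ (Fin 3)) (t₁ : EuclideanSpace ℝ (Fin 3))
    (A₂ : EuclideanSpace ℝ (Fin 3) ≃ₗᵢ[ℝ] EuclideanSpace ℝ (Fin 3)) (t₂ : EuclideanSpace ℝ (Fin 3))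
    {z : EuclideanSpace ℝ (Fin 3)} (hz : ‖z‖ = 1)
    {u₁ : EuclideanSpace ℝ (Fin 3)} (hu₁ : u₁ ∈ fccSlots) (hsteep₁ : Real.sqrt 2 / 2 ≤ ⟪A₁ u₁, z⟫_ℝ)
    {δ : ℝ} (hδ : 0 < δ) (hup : δ ≤ (A₁ u₁) 2)
    (M₁ : Set (EuclideanSpace ℝ (Fin 3) ≃ₗᵢ[ℝ] EuclideanSpace ℝ (Fin 3)))
    (hM₁ : ∀ stk : List WalkEntry, StackSound z stk → StackWF z stk → stk.getLast? = some ⟨A₁, u₁, 0⟩ →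
      ∀ e ∈ stk, e.frame ∈ M₁)
    (hmiss : ∀ F ∈ M₁, F '' fccStacking 1 (Real.sqrt (2 / 3)) ≠ A₂ '' fccStacking 1 (Real.sqrt (2 / 3)))
    (hdirs : ∀ stk : List WalkEntry, StackSound z stk → StackWF z stk → stk.getLast? = some ⟨A₁, u₁, 0⟩ →
      ∀ e rest, stk = e :: rest → 0 ≤ (e.frame e.dir) 2) :
    TwoSlabLedgerAt (Real.sqrt 2 * |⟪A₁ u₁, EuclideanSpace.single (2 : Fin 3) (1 : ℝ)⟫_ℝ| / 2) A₁ t₁ A₂ t₂ :=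
  twoSlabAdhesion_stackLedger_oneSided_dirs hs₀ hcert (doubleStarCoaxialAt_of_starPairFar hSP)
    (capPairCoaxial_of_starPairFar hSP) A₁ t₁ A₂ t₂ hz hu₁ hsteep₁ hδ hup M₁ hM₁ hmiss hdirs

open scoped Classical in
/-- **Charge `½κ₁` from grain 1 alone, any steering, weak direction floor** (abstract frame set `M₁`), modulo `ExactOnly`(C12-55)
and `StarPairFar`. -/
theorem genericWallFloorAtCharge_oneSided_dirs_of_far
    {s₀ : EuclideanSpace ℝ (Fin 3)} (hs₀ : s₀ ∈ fccSlots)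
    (hcert : ExactOnly 0 (fccSlots.filter fun w => 0 < ⟪w, s₀⟫_ℝ)) (hSP : StarPairFar)
    (A₁ : EuclideanSpace ℝ (Fin 3) ≃ₗᵢ[ℝ] EuclideanSpace ℝ (Fin 3)) (t₁ : EuclideanSpace ℝ (Fin 3))
    (A₂ : EuclideanSpace ℝ (Fin 3) ≃ₗᵢ[ℝ] EuclideanSpace ℝ (Fin 3)) (t₂ : EuclideanSpace ℝ (Fin 3))
    {z : EuclideanSpace ℝ (Fin 3)} (hz : ‖z‖ = 1)
    {u₁ : EuclideanSpace ℝ (Fin 3)} (hu₁ : u₁ ∈ fccSlots) (hsteep₁ : Real.sqrt 2 / 2 ≤ ⟪A₁ u₁, z⟫_ℝ)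
    {δ : ℝ} (hδ : 0 < δ) (hup : δ ≤ (A₁ u₁) 2)
    (M₁ : Set (EuclideanSpace ℝ (Fin 3) ≃ₗᵢ[ℝ] EuclideanSpace ℝ (Fin 3)))
    (hM₁ : ∀ stk : List WalkEntry, StackSound z stk → StackWF z stk → stk.getLast? = some ⟨A₁, u₁, 0⟩ →
      ∀ e ∈ stk, e.frame ∈ M₁)
    (hmiss : ∀ F ∈ M₁, F '' fccStacking 1 (Real.sqrt (2 / 3)) ≠ A₂ '' fccStacking 1 (Real.sqrt (2 / 3)))
    (hdirs : ∀ stk : List WalkEntry, StackSound z stk → StackWF z stk → stk.getLast? = some ⟨A₁, u₁, 0⟩ →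
      ∀ e rest, stk = e :: rest → 0 ≤ (e.frame e.dir) 2) :
    GenericWallFloorAtCharge (Real.sqrt 2 * |⟪A₁ u₁, EuclideanSpace.single (2 : Fin 3) (1 : ℝ)⟫_ℝ| / 2) A₁ t₁ A₂ t₂ :=
  genericWallFloorAtCharge_of_ledger _ A₁ t₁ A₂ t₂
    (twoSlabLedgerAt_oneSided_dirs hs₀ hcert hSP A₁ t₁ A₂ t₂ hz hu₁ hsteep₁ hδ hup M₁ hM₁ hmiss hdirs)

open scoped Classical in
/-- **Charge `½κ₁ = (√2/2)·(A₁u₁)₂` from grain 1 alone, any steering, weak direction floor, CANONICAL frame set**: the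
lattice-separation hypothesis is stated directly on the frames of sound well-formed `z`-stacks over `⟨A₁, u₁, 0⟩`; modulo
`ExactOnly`(C12-55) and `StarPairFar`. -/
theorem genericWallFloorAtCharge_oneSided_dirs
    {s₀ : EuclideanSpace ℝ (Fin 3)} (hs₀ : s₀ ∈ fccSlots)
    (hcert : ExactOnly 0 (fccSlots.filter fun w => 0 < ⟪w, s₀⟫_ℝ)) (hSP : StarPairFar)
    (A₁ : EuclideanSpace ℝ (Fin 3) ≃ₗᵢ[ℝ] EuclideanSpace ℝ (Fin 3)) (t₁ : EuclideanSpace ℝ (Fin 3))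
    (A₂ : EuclideanSpace ℝ (Fin 3) ≃ₗᵢ[ℝ] EuclideanSpace ℝ (Fin 3)) (t₂ : EuclideanSpace ℝ (Fin 3))
    {z : EuclideanSpace ℝ (Fin 3)} (hz : ‖z‖ = 1)
    {u₁ : EuclideanSpace ℝ (Fin 3)} (hu₁ : u₁ ∈ fccSlots) (hsteep₁ : Real.sqrt 2 / 2 ≤ ⟪A₁ u₁, z⟫_ℝ)
    {δ : ℝ} (hδ : 0 < δ) (hup : δ ≤ (A₁ u₁) 2)
    (hmiss : ∀ stk : List WalkEntry, StackSound z stk → StackWF z stk → stk.getLast? = some ⟨A₁, u₁, 0⟩ →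
      ∀ e ∈ stk, e.frame '' fccStacking 1 (Real.sqrt (2 / 3)) ≠ A₂ '' fccStacking 1 (Real.sqrt (2 / 3)))
    (hdirs : ∀ stk : List WalkEntry, StackSound z stk → StackWF z stk → stk.getLast? = some ⟨A₁, u₁, 0⟩ →
      ∀ e rest, stk = e :: rest → 0 ≤ (e.frame e.dir) 2) :
    GenericWallFloorAtCharge (Real.sqrt 2 * (A₁ u₁) 2 / 2) A₁ t₁ A₂ t₂ := by
  have he₃i : ⟪A₁ u₁, EuclideanSpace.single (2 : Fin 3) (1 : ℝ)⟫_ℝ = (A₁ u₁) 2 := by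
    rw [EuclideanSpace.inner_single_right]; simp
  have habs : |⟪A₁ u₁, EuclideanSpace.single (2 : Fin 3) (1 : ℝ)⟫_ℝ| = (A₁ u₁) 2 := by
    rw [he₃i]; exact abs_of_nonneg (by linarith)
  have h := genericWallFloorAtCharge_oneSided_dirs_of_far hs₀ hcert hSP A₁ t₁ A₂ t₂ hz hu₁ hsteep₁ hδ hup
    {F | ∃ stk : List WalkEntry, StackSound z stk ∧ StackWF z stk ∧ stk.getLast? = some ⟨A₁, u₁, 0⟩ ∧
      ∃ e ∈ stk, e.frame = F}
    (fun stk hS hW hlast e he => ⟨stk, hS, hW, hlast, e, he, rfl⟩)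
    (fun _ ⟨stk, hS, hW, hl, e, he, hF⟩ => by rw [← hF]; exact hmiss stk hS hW hl e he) hdirs
  rw [habs] at h
  exact h

open scoped Classical in
/-- **Word floor, any steering**: chain pair `A₂·Λ₀ = (wordFrame A₁ κ)·Λ₀` with `|κ| ≥ 2`, slot `u₁` IN the first mirror
plane, steep for SOME unit steering `z` and rising in true height by `δ > 0`, whose walker family satisfies the weak direction
floor `hdirs`: `GenericWallFloorAtCharge ((√2/2)·(A₁u₁)₂)`, modulo `ExactOnly`(C12-55) and `StarPairFar`.  (The frames of the
family never carry the far lattice: `image_ne_of_word`, which is steering-free.) -/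
theorem genericWallFloorAtCharge_word_dirs
    {s₀ : EuclideanSpace ℝ (Fin 3)} (hs₀ : s₀ ∈ fccSlots)
    (hcert : ExactOnly 0 (fccSlots.filter fun w => 0 < ⟪w, s₀⟫_ℝ)) (hSP : StarPairFar)
    (A₁ : EuclideanSpace ℝ (Fin 3) ≃ₗᵢ[ℝ] EuclideanSpace ℝ (Fin 3)) (t₁ : EuclideanSpace ℝ (Fin 3))
    (A₂ : EuclideanSpace ℝ (Fin 3) ≃ₗᵢ[ℝ] EuclideanSpace ℝ (Fin 3)) (t₂ : EuclideanSpace ℝ (Fin 3))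
    {z : EuclideanSpace ℝ (Fin 3)} (hz : ‖z‖ = 1)
    {u₁ : EuclideanSpace ℝ (Fin 3)} (hu₁ : u₁ ∈ fccSlots) (hsteep₁ : Real.sqrt 2 / 2 ≤ ⟪A₁ u₁, z⟫_ℝ)
    {δ : ℝ} (hδ : 0 < δ) (hup : δ ≤ (A₁ u₁) 2)
    (κ : List (EuclideanSpace ℝ (Fin 3)))
    (hκl : ∀ μ ∈ κ, ‖μ‖ = 1 ∧
      ∀ w ∈ fccSlots, ⟪w, μ⟫_ℝ = 0 ∨ ⟪w, μ⟫_ℝ = Real.sqrt (2 / 3) ∨ ⟪w, μ⟫_ℝ = -Real.sqrt (2 / 3))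
    (hκc : List.IsChain (fun μ μ' => ⟪μ, μ'⟫_ℝ = 1 / 3 ∨ ⟪μ, μ'⟫_ℝ = -1 / 3) κ) (hκ2 : 2 ≤ κ.length)
    (hA₂ : A₂ '' fccStacking 1 (Real.sqrt (2 / 3)) = (wordFrame A₁ κ) '' fccStacking 1 (Real.sqrt (2 / 3)))
    (hfirst : ∀ μ, κ.getLast? = some μ → ⟪u₁, μ⟫_ℝ = 0)
    (hdirs : ∀ stk : List WalkEntry, StackSound z stk → StackWF z stk → stk.getLast? = some ⟨A₁, u₁, 0⟩ →
      ∀ e rest, stk = e :: rest → 0 ≤ (e.frame e.dir) 2) :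
    GenericWallFloorAtCharge (Real.sqrt 2 * (A₁ u₁) 2 / 2) A₁ t₁ A₂ t₂ :=
  genericWallFloorAtCharge_oneSided_dirs hs₀ hcert hSP A₁ t₁ A₂ t₂ hz hu₁ hsteep₁ hδ hup
    (fun _ hS hW hl _ he => image_ne_of_word κ hκl hκc hκ2 hA₂ hfirst hS hW hl he) hdirs

end Summit.Ventures.Crystal3D.Theorems

end
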